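import Summits.NavierStokesRegularity.NavierStokesRegularity.Theorems.RellichScarTypeIBlowupProfile
import HarnessLib

/-!
# Seregin's Albritton–Barker extraction at a given backward-singular point, with explicit zooms
# (route `AdaptedFrequency`; sub-goal W2 of the enabler `tangentFlowTransfer_finiteAB` for the
# crux `FrequencyRigidity`, stmt-NavierStokesRegularity-2955, line `scaled-energy-split`)

For a classical solution `(u, p)` of the Navier–Stokes system (viscosity `ν > 0`) on `[0, T)`,
Leray–Hopf from `u 0`, blowing up at the Type-I rate, and a GIVEN backward-singular point
`(T, x₀)` of `u`, we run steps (1)–(7) of the tree proof `typeIBlowupProfile_proof`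
(`RellichScarTypeIBlowupProfile.lean`) at that point: the Morrey bound (`morrey_of_typeI`), the
viscosity-normalising zoom about `(T, x₀)` at a scale `R` (`exists_zoom_typeIBound_lt_top_of_morrey`,
Albritton–Barker Lemma 2.6), a further zoom by `1/2`, Seregin's zoom-in extraction at the singular
origin (`Seregin2020.exists_ancientLimit`) and the slab class with `𝐈 ≤ 4 𝐈(Q(0, 1))`
(`slab_typeIBound_of_zoomLimit`).  The only new point is bookkeeping: the approximating zooms are
recorded as EXPLICIT zooms `λⱼ • stPull (λⱼ²) λⱼ 0 0 ((R'/ν) • stPull (R'²/ν) R' T x₀ u)` of `u`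
itself (`R' = R/2`), so that the route's `C²_loc` extraction can be run along the same scales and
the two limits identified almost everywhere.
-/

noncomputable section

set_option linter.dupNamespace false

namespace Summit.NavierStokesRegularity.NavierStokesRegularity.Theorems

open MeasureTheory Set Function Filter Topology TopologicalSpace Metric
open Literature.Analysis.FluidPDE Literature.Analysis.FluidPDE.SereginSverak2009
open scoped NNReal ENNReal

/-- **Seregin's Albritton–Barker extraction at a given backward-singular point, explicit zooms.**
Let `(u, p)` be a classical solution of Navier–Stokes (viscosity `ν > 0`) on `ℝ³ × [0, T)`,
Leray–Hopf from `u 0`, blowing up at the Type-I rate, and let `(T, x₀)` be a backward-singular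
point of `u` (`u ∉ L^∞(Q((T, x₀), r))` for every `r > 0`). Then there are a scale `R > 0`, scales
`λⱼ > 0`, `λⱼ → 0`, and a triple `(w, ϖ, H)` — a suitable weak solution of the unit-viscosity
system on the backward slab `ℝ³ × ℝ₋` with weak spatial gradient `H` and finite Albritton–Barker
quantity `𝐈(ℝ³ × ℝ₋) < ∞` — such that on every parabolic ball `Q(0, a)` the limit `w` is in `L³`
and the zooms `λⱼ v(λⱼ² s, λⱼ y)` of the viscosity-normalising zoom
`v = (R/ν) u(T + (R²/ν) s, x₀ + R y)` converge to `w` in `L³(Q(0, a))`. Proof: steps (1)–(7) of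
`typeIBlowupProfile_proof` run at the given point — Morrey bound of a Type-I solution
(`morrey_of_typeI`), the zoom of Albritton–Barker Lemma 2.6
(`exists_zoom_typeIBound_lt_top_of_morrey`), backward singularity of the zoom at the origin, a
second zoom by `1/2`, Seregin's zoom-in extraction (`Seregin2020.exists_ancientLimit`, Seregin 2014
Prop. 6.20) and `𝐈 ≤ 4 𝐈(Q(0, 1))` on the slab (`slab_typeIBound_of_zoomLimit`); finally the
composite of the two zooms is rewritten as the single zoom at scale `R/2`.
[cite: AlbrittonBarker2019, §3 and Remark 3.2; Seregin2014, §6.6 Prop. 6.20] -/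
theorem finiteAB_exists_abZoomLimit_at : ∀ (ν T : ℝ), 0 < ν → 0 < T → ∀ (u : ℝ → EuclideanSpace ℝ (Fin 3) → EuclideanSpace ℝ (Fin 3)) (p : ℝ → EuclideanSpace ℝ (Fin 3) → ℝ), Literature.Analysis.FluidPDE.IsClassicalNSSolutionOn (Set.Ico 0 T) ν 0 u p → Literature.Analysis.FluidPDE.IsLerayHopfOn T ν 0 (u 0) u → Literature.Analysis.FluidPDE.IsTypeIBlowup u T → ∀ (x₀ : EuclideanSpace ℝ (Fin 3)), (∀ r : ℝ, 0 < r → MeasureTheory.eLpNorm (Function.uncurry u) ⊤ (MeasureTheory.Measure.restrict MeasureTheory.volume (Literature.Analysis.FluidPDE.parabolicCylinder r (T, x₀))) = ⊤) → ∃ (R : ℝ) (lam : ℕ → ℝ) (w : ℝ → EuclideanSpace ℝ (Fin 3) → EuclideanSpace ℝ (Fin 3)) (ϖ : ℝ → EuclideanSpace ℝ (Fin 3) → ℝ) (H : ℝ → EuclideanSpace ℝ (Fin 3) → EuclideanSpace ℝ (Fin 3) →L[ℝ] EuclideanSpace ℝ (Fin 3)), 0 < R ∧ (∀ j, 0 <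 lam j) ∧ Filter.Tendsto lam Filter.atTop (nhds 0) ∧ Literature.Analysis.FluidPDE.IsSuitableWeakSolutionOn (Literature.Analysis.FluidPDE.slab (EuclideanSpace ℝ (Fin 3)) (Set.Iio 0) isOpen_Iio) 1 0 w ϖ ∧ Literature.Analysis.FluidPDE.HasWeakSpatialGradientOn (Literature.Analysis.FluidPDE.slab (EuclideanSpace ℝ (Fin 3)) (Set.Iio 0) isOpen_Iio) w H ∧ Literature.Analysis.FluidPDE.typeIBound (Set.Iio (0:ℝ) ×ˢ Set.univ) w ϖ H < ⊤ ∧ (∀ a : ℝ, 0 < a → MeasureTheory.MemLp (Function.uncurry w) 3 (MeasureTheory.Measure.restrict MeasureTheory.volume (Literature.Analysis.FluidPDE.parabolicCylinder a (0 : ℝ × EuclideanSpace ℝ (Fin 3)))) ∧ Filter.Tendsto (fun j => MeasureTheory.eLpNorm (Function.uncurry ((lam j) • Literature.Analysis.FluidPDE.stPull ((lam j) ^ 2) (lam j) (0 : ℝ) (0 : EuclideanSpace ℝ (Fin 3)) ((R / ν) • Literature.Analysis.FluidPDE.stPull (R ^ 2 / ν) R T x₀ u)) - Function.uncurry w) 3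 (MeasureTheory.Measure.restrict MeasureTheory.volume (Literature.Analysis.FluidPDE.parabolicCylinder a (0 : ℝ × EuclideanSpace ℝ (Fin 3))))) Filter.atTop (nhds 0)) := by
  intro ν T hν hT u p hsol hLH hI x₀ hsingu
  -- proof adapted from `typeIBlowupProfile_proof` (steps (1)–(7), at the given singular point)
  -- ## (1) Morrey bound and the viscosity-normalising zoom about `(T, x₀)`
  obtain ⟨r₀, M₀, T₁, hr₀, hT₁, hMor⟩ := morrey_of_typeI hν hT hsol hLH hI
  obtain ⟨R, α, β, hR, hα, hβ, hβdef, hαdef, hβT, hball, hGv, htypeI⟩ :=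
    exists_zoom_typeIBound_lt_top_of_morrey hν hT hsol hLH hr₀ hT₁ hMor x₀
  set q : ℝ → EuclideanSpace ℝ (Fin 3) → ℝ :=
    fun t x => p t x - (p t 0 - normalisedPressure (u t) 0)
  set v : ℝ → EuclideanSpace ℝ (Fin 3) → EuclideanSpace ℝ (Fin 3) := α • stPull β R T x₀ u with hv
  set πv : ℝ → EuclideanSpace ℝ (Fin 3) → ℝ := α ^ 2 • stPull β R T x₀ q
  set Gv : ℝ → EuclideanSpace ℝ (Fin 3) → EuclideanSpace ℝ (Fin 3) →L[ℝ] EuclideanSpace ℝ (Fin 3) :=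
    (α * R) • stPull β R T x₀ (fun t x => fderiv ℝ (u t) x)
  -- ## (2) the origin is a backward singular point of the zoom
  have hnotbd : ¬ IsBackwardBoundedAt u T x₀ := by
    rintro ⟨r, hr, K, hK⟩
    have hfin : eLpNorm (uncurry u) ∞
        (volume.restrict (parabolicCylinder r ((T : ℝ), x₀))) < ∞ := by
      rw [eLpNorm_exponent_top]
      refine eLpNormEssSup_lt_top_of_ae_bound (C := K) ?_
      refine (ae_restrict_mem (isOpen_parabolicCylinder r _).measurableSet).mono ?_
      rintro ⟨t, x⟩ hz
      rw [mem_parabolicCylinder] at hz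
      exact hK t ⟨hz.1.1, hz.1.2⟩ x (mem_ball.2 hz.2)
    exact hfin.ne (hsingu r hr)
  have hsing : IsBackwardSingularPoint v (0 : ℝ × EuclideanSpace ℝ (Fin 3)) := by
    intro r hr
    by_contra hfin
    have hfin' : eLpNorm (uncurry v) ⊤
        (volume.restrict (parabolicCylinder (min r 1) (0 : ℝ × EuclideanSpace ℝ (Fin 3)))) < ⊤ := by
      refine lt_of_le_of_lt (eLpNorm_mono_measure _ (Measure.restrict_mono ?_ le_rfl))
        (lt_top_iff_ne_top.2 hfin)
      exact SuitableCompactness.parabolicCylinder_zero_mono (le_min hr.le zero_le_one) (min_le_left _ _)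
    exact hnotbd (SereginSverak2002.isBackwardBoundedAt_of_zoom hsol x₀ hR hα hβ hβT
      (lt_min hr one_pos) (min_le_right _ _) hfin')
  -- ## (3) the second zoom by `1/2`: the class on `Q(0, 2) ⊇ 𝒞 × (−1, 0)`
  have hc : (0 : ℝ) < 1 / 2 := by norm_num
  set v' : ℝ → EuclideanSpace ℝ (Fin 3) → EuclideanSpace ℝ (Fin 3) :=
    (1 / 2 : ℝ) • stPull ((1 / 2 : ℝ) ^ 2) (1 / 2) (0 : ℝ) (0 : EuclideanSpace ℝ (Fin 3)) v with hv'
  set π' : ℝ → EuclideanSpace ℝ (Fin 3) → ℝ :=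
    (1 / 2 : ℝ) ^ 2 • stPull ((1 / 2 : ℝ) ^ 2) (1 / 2) (0 : ℝ) (0 : EuclideanSpace ℝ (Fin 3)) πv
    with hπ'
  set G' : ℝ → EuclideanSpace ℝ (Fin 3) → EuclideanSpace ℝ (Fin 3) →L[ℝ] EuclideanSpace ℝ (Fin 3) :=
    (1 / 2 : ℝ) ^ 2 • stPull ((1 / 2 : ℝ) ^ 2) (1 / 2) (0 : ℝ) (0 : EuclideanSpace ℝ (Fin 3)) Gv
    with hG'def
  have hball' : IsSuitableWeakSolutionInBall 2 0 v' π' := by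
    have h := hball.zoomOut hc
    rwa [show (1 : ℝ) / (1 / 2) = 2 by norm_num] at h
  have hG' : HasWeakSpatialGradientOn
      (parabolicCylinderOpens 2 (0 : ℝ × EuclideanSpace ℝ (Fin 3))) v' G' := by
    have h := hGv.stRescale (1 / 2 : ℝ) (pow_pos hc 2) hc (0 : ℝ) (0 : EuclideanSpace ℝ (Fin 3))
    have hpre : stPreimage ((1 / 2 : ℝ) ^ 2) (1 / 2) (0 : ℝ) (0 : EuclideanSpace ℝ (Fin 3))
        (parabolicCylinderOpens 1 (0 : ℝ × EuclideanSpace ℝ (Fin 3))) =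
        parabolicCylinderOpens 2 (0 : ℝ × EuclideanSpace ℝ (Fin 3)) := by
      apply Opens.ext
      rw [coe_stPreimage, coe_parabolicCylinderOpens, coe_parabolicCylinderOpens,
        stAffine_preimage_parabolicCylinder_zero hc, show (1 : ℝ) / (1 / 2) = 2 by norm_num]
    rw [hpre, ← sq] at h
    exact h
  have hI' : typeIBound (parabolicCylinder 1 (0 : ℝ × EuclideanSpace ℝ (Fin 3))) v' π' G' < ⊤ := by
    have h := typeIBound_nsZoom hc (0 : ℝ) (0 : EuclideanSpace ℝ (Fin 3))
      (parabolicCylinder (1 / 2) (0 : ℝ × EuclideanSpace ℝ (Fin 3))) v πv Gv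
    rw [stAffine_preimage_parabolicCylinder_zero hc, show (1 / 2 : ℝ) / (1 / 2) = 1 by norm_num] at h
    rw [hv', hπ', hG'def, h]
    exact htypeI
  have hsing' : IsBackwardSingularPoint v' (0 : ℝ × EuclideanSpace ℝ (Fin 3)) := by
    intro r hr
    rw [hv', eLpNorm_top_nsZoom hc, Seregin2020.stAffine_zero_zero_apply_zero,
      hsing ((1 / 2) * r) (by positivity)]
    exact ENNReal.mul_top (by simp)
  -- ## (4) the inputs of the zoom-in extraction on `𝒞 × (−1, 0) ⊆ Q(0, 2)`
  have hsqrt2 : Real.sqrt 2 ≤ 2 := by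
    rw [Real.sqrt_le_left (by norm_num)]
    norm_num
  have hPQ : parCyl (0 : ℝ × EuclideanSpace ℝ (Fin 3)) 1 ⊆
      parabolicCylinder 2 (0 : ℝ × EuclideanSpace ℝ (Fin 3)) := by
    intro z hz
    obtain ⟨ht, hx⟩ := hz
    have hx' := spaceCyl_subset_ball (0 : EuclideanSpace ℝ (Fin 3)) zero_le_one hx
    rw [mul_one, mem_ball_zero_iff] at hx'
    simp only [Prod.fst_zero, one_pow, zero_sub, mem_Ioo] at ht
    rw [SuitableCompactness.mem_parabolicCylinder_zero]
    exact ⟨⟨by linarith [ht.1], ht.2⟩, lt_of_lt_of_le hx' hsqrt2⟩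
  have hle : parCylOpens (0 : ℝ × EuclideanSpace ℝ (Fin 3)) 1 ≤
      parabolicCylinderOpens 2 (0 : ℝ × EuclideanSpace ℝ (Fin 3)) := fun z hz => hPQ hz
  have hsw3 : IsSuitableWeakSolutionOn (parCylOpens (0 : ℝ × EuclideanSpace ℝ (Fin 3)) 1) 1 0 v' π' :=
    IsSuitableWeakSolutionOn.mono_holds hball'.1 hle
  have hA3 : ∃ Cc : ℝ≥0, ∀ᵐ t ∂(volume.restrict (Ioo (-1 : ℝ) 0)),
      ∫⁻ x in spaceCyl (0 : EuclideanSpace ℝ (Fin 3)) 1, ‖v' t x‖ₑ ^ 2 ≤ Cc := by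
    obtain ⟨Cc, hCc⟩ := hball'.2.1
    refine ⟨Cc, ?_⟩
    have hsub : Ioo (-1 : ℝ) 0 ⊆ Ioo ((0 : ℝ × EuclideanSpace ℝ (Fin 3)).1 - 2 ^ 2)
        (0 : ℝ × EuclideanSpace ℝ (Fin 3)).1 := by
      intro t ht
      simp only [Prod.fst_zero, zero_sub, mem_Ioo]
      exact ⟨by linarith [ht.1], ht.2⟩
    have hballsub : spaceCyl (0 : EuclideanSpace ℝ (Fin 3)) 1 ⊆
        ball (0 : ℝ × EuclideanSpace ℝ (Fin 3)).2 2 := by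
      refine (spaceCyl_subset_ball (0 : EuclideanSpace ℝ (Fin 3)) zero_le_one).trans ?_
      rw [mul_one, Prod.snd_zero]
      exact ball_subset_ball hsqrt2
    filter_upwards [ae_restrict_of_ae_restrict_of_subset hsub hCc] with t ht
    exact (lintegral_mono_set hballsub).trans ht
  have hG3 : HasWeakSpatialGradientOn (parCylOpens (0 : ℝ × EuclideanSpace ℝ (Fin 3)) 1) v' G' :=
    hG'.mono hle
  have hE3 : ∫⁻ z in parCyl (0 : ℝ × EuclideanSpace ℝ (Fin 3)) 1,
      ENNReal.ofReal (frobeniusNormSq (G' z.1 z.2)) < ∞ := by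
    obtain ⟨G'', hG'', hG''2⟩ := hball'.2.2.1
    have hae := hG'.ae_eq hG''
    rw [coe_parabolicCylinderOpens] at hae
    refine lt_of_le_of_lt (lintegral_mono_set hPQ) ?_
    have e : ∫⁻ z in parabolicCylinder 2 (0 : ℝ × EuclideanSpace ℝ (Fin 3)),
        ENNReal.ofReal (frobeniusNormSq (G' z.1 z.2)) =
        ∫⁻ z in parabolicCylinder 2 (0 : ℝ × EuclideanSpace ℝ (Fin 3)),
        ENNReal.ofReal (frobeniusNormSq (G'' z.1 z.2)) := by
      refine lintegral_congr_ae ?_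
      filter_upwards [hae] with z hz
      have hz' : G' z.1 z.2 = G'' z.1 z.2 := hz
      rw [hz']
    rw [e]
    exact hG''2
  have hp3 : ∫⁻ z in parCyl (0 : ℝ × EuclideanSpace ℝ (Fin 3)) 1,
      ‖π' z.1 z.2‖ₑ ^ (3 / 2 : ℝ) < ∞ := by
    obtain ⟨-, h32', h32r⟩ := threeHalves_facts
    have hm : MemLp (uncurry π') (3 / 2)
        (volume.restrict (parabolicCylinder 2 (0 : ℝ × EuclideanSpace ℝ (Fin 3)))) := hball'.2.2.2
    have h2 := hm.2
    rw [eLpNorm_eq_lintegral_rpow_enorm_toReal (by norm_num) h32', h32r] at h2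
    have hfin : ∫⁻ z in parabolicCylinder 2 (0 : ℝ × EuclideanSpace ℝ (Fin 3)),
        ‖uncurry π' z‖ₑ ^ (3 / 2 : ℝ) < ∞ := by
      by_contra htop
      rw [not_lt, top_le_iff] at htop
      rw [htop, ENNReal.top_rpow_of_pos (by norm_num)] at h2
      exact lt_irrefl _ h2
    exact lt_of_le_of_lt (lintegral_mono_set hPQ) hfin
  have hI3 : Seregin2020.blowupIndex 0 v' G' < ∞ := by
    refine lt_of_le_of_lt (Seregin2020.blowupIndex_le_limsup_cknC 0 v' G') (lt_of_le_of_lt ?_ hI')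
    refine limsup_le_of_le (by isBoundedDefault) ?_
    filter_upwards [Ioo_mem_nhdsGT (zero_lt_one' ℝ)] with r hr
    exact cknC_le_abScaledSum.trans (abScaledSum_le_typeIBound hr.1
      (SuitableCompactness.parabolicCylinder_zero_mono hr.1.le hr.2.le))
  -- ## (5) the zoom-in limit at the singular origin
  obtain ⟨K, κ, lam, w, ϖ, -, hlam, hlam0, -, hlimw⟩ :=
    Seregin2020.exists_ancientLimit hsw3 hA3 hG3 hE3 hp3 hsing' hI3
  -- ## (6) the slab class with `𝐈 ≤ 4 𝐈(Q(0,1))`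
  have hball1 : IsSuitableWeakSolutionInBall 1 0 v' π' :=
    SuitableCompactness.isSuitableWeakSolutionInBall_of_le_radius hball' (by norm_num) (by norm_num)
  have hG1 : HasWeakSpatialGradientOn
      (parabolicCylinderOpens 1 (0 : ℝ × EuclideanSpace ℝ (Fin 3))) v' G' :=
    hG'.mono (SuitableCompactness.parabolicCylinderOpens_zero_mono (by norm_num) (by norm_num))
  obtain ⟨hsww, H, hH, h4I⟩ := slab_typeIBound_of_zoomLimit
    (typeIBound (parabolicCylinder 1 (0 : ℝ × EuclideanSpace ℝ (Fin 3))) v' π' G') hI' one_pos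
    hball1 hG1 le_rfl hlam hlam0
    (fun a ha => ⟨(hlimw a ha).1, (hlimw a ha).2.1, (hlimw a ha).2.2.1, (hlimw a ha).2.2.2.1⟩)
  have h4top : typeIBound (Iio (0 : ℝ) ×ˢ univ) w ϖ H < ∞ :=
    lt_of_le_of_lt h4I (ENNReal.mul_lt_top (by simp) hI')
  -- ## (7) the composite zoom is the single zoom at scale `R/2`
  have hvV : v' = (R / 2 / ν) • stPull ((R / 2) ^ 2 / ν) (R / 2) T x₀ u := by
    funext s y
    simp only [hv', hv, smul_stPull_apply, smul_smul, zero_add]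
    rw [hαdef, hβdef]
    have e1 : 1 / 2 * (R / ν) = R / 2 / ν := by ring
    have e2 : T + R ^ 2 / ν * ((1 / 2) ^ 2 * s) = T + (R / 2) ^ 2 / ν * s := by ring
    have e3 : R * (1 / 2) = R / 2 := by ring
    rw [e1, e2, e3]
  refine ⟨R / 2, lam, w, ϖ, H, by positivity, hlam, hlam0, hsww, hH, h4top, fun a ha => ?_⟩
  refine ⟨(hlimw a ha).2.1, ?_⟩
  have h := (hlimw a ha).2.2.1
  rw [hvV] at h
  exact h

end Summit.NavierStokesRegularity.NavierStokesRegularity.Theorems
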